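import Mathlib
import HarnessLib
import HarnessLib.Audit
import Literature.Analysis.FunctionSpaces.BesselJZeroSqrtLaplace
import Summits.ValiantsHypothesis.ValiantsHypothesis.Theorems.LacunarySymmetroidMatrixDescartesToyALawRolle

/-!
# ValiantsHypothesis / LacunarySymmetroid — crux `MatrixDescartes` (stmt-ValiantsHypothesis-18050, V1), LINE (A) «product_plus_one»:
# binomial-limit TOY THEOREM, module 5 — the Laplace side and Laguerre's transfer (Pólya–Szegő II, V.80)

For a density `g` continuous on `(0, ∞)` and dominated by a polynomial, the Laplace transform
`G(Y) = ∫₀^∞ e^{−Yθ} g(θ) dθ` is differentiable on `(0, ∞)` with `(c + d/dY) G = ∫₀^∞ e^{−Yθ} (c − θ) g(θ) dθ`, and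
`G > 0` when `g ≥ 0` is not identically zero.  LAGUERRE'S TRANSFER (`card_posRoots_le_of_laplace_multiplier`): if
`N/D = G` on `(0, ∞)` for real polynomials `N, D` (`D ≠ 0` there) and `(∏_{j<V} (c j − θ))·g(θ)` is one-signed on `(0,∞)`,
then `N` has at most `V` positive roots counted with multiplicity — induction on `V` with the generalized Rolle bound of
module 3 (`…ToyALawRolle`).  With module 4 this is Pólya–Szegő II, Part V, Problem 80 («`Z ≤ R`») for such densities, the
second cited fact of pen val-idea-25 g8 NOTE §54.13.  Euler integrals from `Literature.Analysis.FunctionSpaces`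
(`integral_pow_mul_exp_neg_mul_Ioi`).  NEAREST TREE FACT (cite, not used): `Literature/Analysis/TotalPositivity/
LaguerreLaplaceRuleOfSigns.lean` proves Pólya–Szegő V.77/V.80 (`polyaSzego_V80_laplace_zeros_le_signReversals_holds`) in the
analytic currency `ZerosWithMultiplicityLE`/`SignReversalsLE`; the present module is the same Laguerre induction in the
POLYNOMIAL-NUMERATOR currency (`Polynomial.roots` multiplicities of `N` with `N/D` the transform), which is what `toyALaw` states.

HONEST FRAMING: generic real-analysis helper; no stub of LINE (A) is touched; `MatrixDescartes` OPEN; `VP ≠ VNP` is NOT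
proved and nothing here bears on it.
-/

set_option linter.dupNamespace false

namespace Summit.ValiantsHypothesis.ValiantsHypothesis.Theorems.LacunarySymmetroidMatrixDescartes

namespace ToyALaw

open Polynomial Finset Set MeasureTheory Filter
open Literature.Analysis.FunctionSpaces (integral_pow_mul_exp_neg_mul_Ioi integrableOn_pow_mul_exp_neg_mul_Ioi)

/-! ## Integrability against `e^{−Yθ}` of polynomially dominated densities -/

/-- `θ ↦ e^{−Yθ} B(θ)` is integrable on `(0,∞)` for every real polynomial `B` and `Y > 0` (termwise Euler integrals),
in absolute value: `θ ↦ e^{−Yθ} Σ_k |b_k| θ^k`. -/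
theorem integrableOn_exp_neg_mul_polyAbs {Y : ℝ} (hY : 0 < Y) (B : ℝ[X]) :
    IntegrableOn (fun θ : ℝ => Real.exp (-(Y * θ)) * ∑ k ∈ range (B.natDegree + 1), |B.coeff k| * θ ^ k) (Ioi 0) := by
  have : (fun θ : ℝ => Real.exp (-(Y * θ)) * ∑ k ∈ range (B.natDegree + 1), |B.coeff k| * θ ^ k) =
      fun θ => ∑ k ∈ range (B.natDegree + 1), |B.coeff k| * (θ ^ k * Real.exp (-(Y * θ))) := by
    funext θ; rw [mul_sum]; refine sum_congr rfl fun k _ => ?_; ring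
  rw [this]
  exact integrable_finsetSum _ fun k _ => (integrableOn_pow_mul_exp_neg_mul_Ioi hY k).const_mul _

/-- A real polynomial is dominated by the sum of the absolute values of its terms on `θ ≥ 0`. -/
theorem abs_eval_le_sum_abs_coeff (B : ℝ[X]) {θ : ℝ} (hθ : 0 ≤ θ) :
    |B.eval θ| ≤ ∑ k ∈ range (B.natDegree + 1), |B.coeff k| * θ ^ k := by
  rw [eval_eq_sum_range]
  refine (abs_sum_le_sum_abs _ _).trans (le_of_eq (sum_congr rfl fun k _ => ?_))
  rw [abs_mul, abs_of_nonneg (pow_nonneg hθ k)]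

/-- **Integrability.** If `g` is continuous on `(0,∞)` and `|g| ≤ B` there for a polynomial `B`, then for `Y > 0` and every
`j`, `θ ↦ e^{−Yθ} θ^j g(θ)` is integrable on `(0,∞)`. -/
theorem integrableOn_exp_neg_mul_pow_mul {g : ℝ → ℝ} (hg : ContinuousOn g (Ioi 0)) {B : ℝ[X]}
    (hB : ∀ θ, 0 < θ → |g θ| ≤ B.eval θ) {Y : ℝ} (hY : 0 < Y) (j : ℕ) :
    IntegrableOn (fun θ : ℝ => Real.exp (-(Y * θ)) * (θ ^ j * g θ)) (Ioi 0) := by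
  have hmeas : AEStronglyMeasurable (fun θ : ℝ => Real.exp (-(Y * θ)) * (θ ^ j * g θ)) (volume.restrict (Ioi 0)) := by
    refine ContinuousOn.aestronglyMeasurable ?_ measurableSet_Ioi
    exact ((by fun_prop : Continuous fun θ : ℝ => Real.exp (-(Y * θ))).continuousOn).mul
      (((by fun_prop : Continuous fun θ : ℝ => θ ^ j)).continuousOn.mul hg)
  have hdom := integrableOn_exp_neg_mul_polyAbs hY (X ^ j * B)
  refine Integrable.mono' hdom hmeas ?_
  refine (ae_restrict_iff' measurableSet_Ioi).2 (Eventually.of_forall fun θ hθ => ?_)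
  have hθ' : (0 : ℝ) < θ := hθ
  rw [norm_mul, norm_mul, Real.norm_eq_abs, Real.norm_eq_abs, Real.norm_eq_abs, abs_of_pos (Real.exp_pos _),
    abs_of_nonneg (pow_nonneg hθ'.le j)]
  refine mul_le_mul_of_nonneg_left ?_ (Real.exp_pos _).le
  calc θ ^ j * |g θ| ≤ θ ^ j * B.eval θ := mul_le_mul_of_nonneg_left (hB θ hθ') (pow_nonneg hθ'.le j)
    _ = (X ^ j * B).eval θ := by simp [eval_mul, eval_pow, eval_X]
    _ ≤ |(X ^ j * B).eval θ| := le_abs_self _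
    _ ≤ _ := abs_eval_le_sum_abs_coeff _ hθ'.le

/-! ## Differentiation under the integral sign -/

/-- **Derivative of the Laplace transform.** For `g` continuous on `(0,∞)`, `|g| ≤ B` (a polynomial) there, and `Y₀ > 0`:
`d/dY ∫₀^∞ e^{−Yθ} g(θ) dθ |_{Y₀} = −∫₀^∞ e^{−Y₀θ} θ g(θ) dθ` (dominated differentiation on `Y > Y₀/2`). -/
theorem hasDerivAt_laplace {g : ℝ → ℝ} (hg : ContinuousOn g (Ioi 0)) {B : ℝ[X]}
    (hB : ∀ θ, 0 < θ → |g θ| ≤ B.eval θ) {Y₀ : ℝ} (hY₀ : 0 < Y₀) :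
    HasDerivAt (fun Y => ∫ θ in Ioi 0, Real.exp (-(Y * θ)) * g θ)
      (∫ θ in Ioi 0, -(Real.exp (-(Y₀ * θ)) * (θ ^ 1 * g θ))) Y₀ := by
  set F : ℝ → ℝ → ℝ := fun Y θ => Real.exp (-(Y * θ)) * g θ with hF
  set F' : ℝ → ℝ → ℝ := fun Y θ => -(Real.exp (-(Y * θ)) * (θ ^ 1 * g θ)) with hF'
  have hs : Ioi (Y₀ / 2) ∈ nhds Y₀ := Ioi_mem_nhds (by linarith)
  have hFcont : ∀ Y, ContinuousOn (F Y) (Ioi 0) := fun Y =>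
    ((by fun_prop : Continuous fun θ : ℝ => Real.exp (-(Y * θ))).continuousOn).mul hg
  have hF_meas : ∀ᶠ Y in nhds Y₀, AEStronglyMeasurable (F Y) (volume.restrict (Ioi 0)) :=
    Eventually.of_forall fun Y => (hFcont Y).aestronglyMeasurable measurableSet_Ioi
  have hF_int : Integrable (F Y₀) (volume.restrict (Ioi 0)) := by
    have := integrableOn_exp_neg_mul_pow_mul hg hB hY₀ 0
    refine this.congr (Eventually.of_forall fun θ => ?_)
    simp [hF]
  have hF'cont : ContinuousOn (F' Y₀) (Ioi 0) :=
    (((by fun_prop : Continuous fun θ : ℝ => Real.exp (-(Y₀ * θ))).continuousOn).mul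
      (((by fun_prop : Continuous fun θ : ℝ => θ ^ 1)).continuousOn.mul hg)).neg
  have hF'_meas : AEStronglyMeasurable (F' Y₀) (volume.restrict (Ioi 0)) :=
    hF'cont.aestronglyMeasurable measurableSet_Ioi
  -- dominating function on Y > Y₀/2
  have hY2 : 0 < Y₀ / 2 := by linarith
  set bound : ℝ → ℝ := fun θ => Real.exp (-(Y₀ / 2 * θ)) *
    ∑ k ∈ range ((X ^ 1 * B).natDegree + 1), |(X ^ 1 * B).coeff k| * θ ^ k with hbound
  have bound_integrable : Integrable bound (volume.restrict (Ioi 0)) :=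
    integrableOn_exp_neg_mul_polyAbs hY2 (X ^ 1 * B)
  have h_bound : ∀ᵐ θ ∂(volume.restrict (Ioi 0)), ∀ Y ∈ Ioi (Y₀ / 2), ‖F' Y θ‖ ≤ bound θ := by
    refine (ae_restrict_iff' measurableSet_Ioi).2 (Eventually.of_forall fun θ hθ Y hY => ?_)
    have hθ' : (0 : ℝ) < θ := hθ
    have hY' : Y₀ / 2 < Y := hY
    simp only [hF', hbound, norm_neg, norm_mul, Real.norm_eq_abs, abs_of_pos (Real.exp_pos _),
      abs_of_nonneg (pow_nonneg hθ'.le 1)]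
    have hexp : Real.exp (-(Y * θ)) ≤ Real.exp (-(Y₀ / 2 * θ)) :=
      Real.exp_le_exp.2 (by nlinarith)
    have hpoly : θ ^ 1 * |g θ| ≤ ∑ k ∈ range ((X ^ 1 * B).natDegree + 1), |(X ^ 1 * B).coeff k| * θ ^ k :=
      calc θ ^ 1 * |g θ| ≤ θ ^ 1 * B.eval θ := mul_le_mul_of_nonneg_left (hB θ hθ') (pow_nonneg hθ'.le 1)
        _ = (X ^ 1 * B).eval θ := by simp [eval_mul, eval_X]
        _ ≤ |(X ^ 1 * B).eval θ| := le_abs_self _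
        _ ≤ _ := abs_eval_le_sum_abs_coeff _ hθ'.le
    have h0 : 0 ≤ θ ^ 1 * |g θ| := mul_nonneg (pow_nonneg hθ'.le 1) (abs_nonneg _)
    calc Real.exp (-(Y * θ)) * (θ ^ 1 * |g θ|) ≤ Real.exp (-(Y₀ / 2 * θ)) * (θ ^ 1 * |g θ|) :=
          mul_le_mul_of_nonneg_right hexp h0
      _ ≤ _ := mul_le_mul_of_nonneg_left hpoly (Real.exp_pos _).le
  have h_diff : ∀ᵐ θ ∂(volume.restrict (Ioi 0)), ∀ Y ∈ Ioi (Y₀ / 2), HasDerivAt (F · θ) (F' Y θ) Y := by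
    refine Eventually.of_forall fun θ Y _ => ?_
    simp only [hF, hF']
    have h1 : HasDerivAt (fun Y : ℝ => Real.exp (-(Y * θ))) (Real.exp (-(Y * θ)) * (-(1 * θ))) Y :=
      ((hasDerivAt_id Y).mul_const θ).neg.exp
    refine (h1.mul_const (g θ)).congr_deriv ?_
    ring
  obtain ⟨_, hderiv⟩ := hasDerivAt_integral_of_dominated_loc_of_deriv_le hs hF_meas hF_int hF'_meas h_bound
    bound_integrable h_diff
  exact hderiv

/-- **`(c + d/dY)` on the Laplace side.** For `Y > 0`:
`c·∫₀^∞ e^{−Yθ} g + ∫₀^∞ (−e^{−Yθ} θ g) = ∫₀^∞ e^{−Yθ} (c − θ) g(θ) dθ`. -/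
theorem laplace_rolle_identity {g : ℝ → ℝ} (hg : ContinuousOn g (Ioi 0)) {B : ℝ[X]}
    (hB : ∀ θ, 0 < θ → |g θ| ≤ B.eval θ) {Y : ℝ} (hY : 0 < Y) (c : ℝ) :
    c * (∫ θ in Ioi 0, Real.exp (-(Y * θ)) * g θ) + (∫ θ in Ioi 0, -(Real.exp (-(Y * θ)) * (θ ^ 1 * g θ))) =
      ∫ θ in Ioi 0, Real.exp (-(Y * θ)) * ((c - θ) * g θ) := by
  have h0 := integrableOn_exp_neg_mul_pow_mul hg hB hY 0
  have h1 := integrableOn_exp_neg_mul_pow_mul hg hB hY 1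
  have h0' : IntegrableOn (fun θ : ℝ => Real.exp (-(Y * θ)) * g θ) (Ioi 0) :=
    h0.congr (Eventually.of_forall fun θ => by simp)
  rw [← integral_const_mul, integral_neg, ← sub_eq_add_neg, ← integral_sub (h0'.const_mul c) h1]
  refine integral_congr_ae (Eventually.of_forall fun θ => ?_)
  simp only [pow_one]
  ring

/-! ## Positivity -/

/-- **Positivity of the Laplace transform.** If `g ≥ 0` on `(0,∞)` is continuous there, polynomially dominated, and
positive at some `θ₀ > 0`, then `∫₀^∞ e^{−Yθ} g(θ) dθ > 0` for every `Y > 0`. -/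
theorem laplace_pos {g : ℝ → ℝ} (hg : ContinuousOn g (Ioi 0)) {B : ℝ[X]}
    (hB : ∀ θ, 0 < θ → |g θ| ≤ B.eval θ) (hnn : ∀ θ, 0 < θ → 0 ≤ g θ) {θ₀ : ℝ} (hθ₀ : 0 < θ₀)
    (hpos : 0 < g θ₀) {Y : ℝ} (hY : 0 < Y) :
    0 < ∫ θ in Ioi 0, Real.exp (-(Y * θ)) * g θ := by
  have hint : IntegrableOn (fun θ : ℝ => Real.exp (-(Y * θ)) * g θ) (Ioi 0) :=
    (integrableOn_exp_neg_mul_pow_mul hg hB hY 0).congr (Eventually.of_forall fun θ => by simp)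
  have hnn' : 0 ≤ᵐ[volume.restrict (Ioi 0)] fun θ => Real.exp (-(Y * θ)) * g θ :=
    (ae_restrict_iff' measurableSet_Ioi).2 (Eventually.of_forall fun θ hθ =>
      mul_nonneg (Real.exp_pos _).le (hnn θ hθ))
  rw [setIntegral_pos_iff_support_of_nonneg_ae hnn' hint]
  -- the support contains a neighbourhood of θ₀ within (0,∞)
  have hcont : ContinuousWithinAt g (Ioi 0) θ₀ := hg θ₀ hθ₀
  obtain ⟨δ, hδ, hδ'⟩ := Metric.continuousWithinAt_iff.1 hcont (g θ₀ / 2) (by linarith)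
  set a := max (θ₀ - δ / 2) (θ₀ / 2) with ha
  have ha0 : 0 < a := lt_of_lt_of_le (by linarith) (le_max_right _ _)
  have haθ : a < θ₀ := max_lt (by linarith) (by linarith)
  have hsub : Ioo a θ₀ ⊆ (Function.support fun θ => Real.exp (-(Y * θ)) * g θ) ∩ Ioi 0 := by
    intro θ hθ
    have hθ0 : 0 < θ := ha0.trans hθ.1
    have hdist : dist θ θ₀ < δ := by
      rw [Real.dist_eq, abs_sub_lt_iff]
      constructor <;> linarith [hθ.1, hθ.2, le_max_left (θ₀ - δ / 2) (θ₀ / 2)]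
    have hclose := hδ' hθ0 hdist
    rw [Real.dist_eq, abs_sub_lt_iff] at hclose
    have hgθ : 0 < g θ := by linarith [hclose.2]
    exact ⟨(mul_pos (Real.exp_pos _) hgθ).ne', hθ0⟩
  exact lt_of_lt_of_le (by rw [Real.volume_Ioo]; exact ENNReal.ofReal_pos.2 (by linarith))
    (measure_mono hsub)

/-! ## Laguerre's transfer -/

/-- Growth bookkeeping: `|(c − θ) g(θ)| ≤ ((|c| + X)·B)(θ)` when `|g| ≤ B` on `(0,∞)`. -/
theorem abs_sub_mul_le {g : ℝ → ℝ} {B : ℝ[X]} (hB : ∀ θ, 0 < θ → |g θ| ≤ B.eval θ) (c : ℝ) :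
    ∀ θ, 0 < θ → |(c - θ) * g θ| ≤ ((C |c| + X) * B).eval θ := by
  intro θ hθ
  have hBnn : 0 ≤ B.eval θ := (abs_nonneg _).trans (hB θ hθ)
  rw [abs_mul, eval_mul, eval_add, eval_C, eval_X]
  refine mul_le_mul ((abs_sub _ _).trans (by rw [abs_of_pos hθ])) (hB θ hθ) (abs_nonneg _) (by positivity)

/-- **Laguerre's transfer** (Pólya–Szegő II, Part V, Problem 80, for polynomially dominated densities and rational Laplace
transforms).  Let `g` be continuous on `(0,∞)` with `|g| ≤ B` (a polynomial), let `N, D ∈ ℝ[X]` with `D(Y) ≠ 0` and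
`N(Y)/D(Y) = ∫₀^∞ e^{−Yθ} g(θ) dθ` for `Y > 0`, and suppose `(∏_{j<V} (c j − θ))·g(θ)` is `≥ 0` on all of `(0,∞)` or `≤ 0` on
all of `(0,∞)`.  Then `N` has at most `V` positive roots counted with multiplicity. -/
theorem card_posRoots_le_of_laplace_multiplier (V : ℕ) :
    ∀ (g : ℝ → ℝ) (B N D : ℝ[X]) (c : ℕ → ℝ), ContinuousOn g (Ioi 0) → (∀ θ, 0 < θ → |g θ| ≤ B.eval θ) →
      (∀ Y, 0 < Y → D.eval Y ≠ 0) →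
      (∀ Y, 0 < Y → N.eval Y / D.eval Y = ∫ θ in Ioi 0, Real.exp (-(Y * θ)) * g θ) →
      ((∀ θ, 0 < θ → 0 ≤ (∏ j ∈ range V, (c j - θ)) * g θ) ∨
        (∀ θ, 0 < θ → (∏ j ∈ range V, (c j - θ)) * g θ ≤ 0)) →
      Multiset.card (N.roots.filter (fun y => 0 < y)) ≤ V := by
  induction V with
  | zero =>
    intro g B N D c hg hB hD hL hsign
    simp only [Finset.prod_range_zero, one_mul] at hsign
    -- reduce to g ≥ 0 by the symmetry (g, N) ↦ (−g, −N)
    suffices key : ∀ (g : ℝ → ℝ) (N : ℝ[X]), ContinuousOn g (Ioi 0) → (∀ θ, 0 < θ → |g θ| ≤ B.eval θ) →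
        (∀ Y, 0 < Y → N.eval Y / D.eval Y = ∫ θ in Ioi 0, Real.exp (-(Y * θ)) * g θ) →
        (∀ θ, 0 < θ → 0 ≤ g θ) → Multiset.card (N.roots.filter (fun y => 0 < y)) ≤ 0 by
      rcases hsign with h | h
      · exact key g N hg hB hL h
      · have := key (fun θ => -g θ) (-N) hg.neg (fun θ hθ => by rw [abs_neg]; exact hB θ hθ)
          (fun Y hY => by
            rw [eval_neg, neg_div, hL Y hY, ← integral_neg]
            exact integral_congr_ae (Eventually.of_forall fun θ => by ring))
          (fun θ hθ => by linarith [h θ hθ])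
        rwa [roots_neg] at this
    intro g N hg hB hL hnn
    rw [Nat.le_zero, Multiset.card_eq_zero, Multiset.filter_eq_nil]
    intro y hy hypos
    by_cases hN : N = 0
    · simp [hN] at hy
    have hNy : N.eval y = 0 := (mem_roots hN).1 hy
    by_cases hex : ∃ θ₀, 0 < θ₀ ∧ 0 < g θ₀
    · obtain ⟨θ₀, hθ₀, hgθ₀⟩ := hex
      have := laplace_pos hg hB hnn hθ₀ hgθ₀ hypos
      rw [← hL y hypos, hNy, zero_div] at this
      exact lt_irrefl _ this
    · -- g ≡ 0 on (0,∞): the transform vanishes, so N vanishes on (0,∞), so N = 0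
      push Not at hex
      have hg0 : ∀ θ, 0 < θ → g θ = 0 := fun θ hθ => le_antisymm (hex θ hθ) (hnn θ hθ)
      apply hN
      apply Polynomial.eq_zero_of_infinite_isRoot
      apply Set.infinite_of_not_bddAbove
      intro ⟨M, hM⟩
      have hz : ∀ z, 0 < z → N.eval z = 0 := by
        intro z hz
        have h1 := hL z hz
        rw [setIntegral_congr_fun measurableSet_Ioi (fun θ (hθ : 0 < θ) => by rw [hg0 θ hθ, mul_zero]),
          integral_zero, div_eq_zero_iff] at h1
        exact h1.resolve_right (hD z hz)
      have h1 : max M 1 + 1 ∈ {x | N.IsRoot x} := hz _ (by positivity)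
      linarith [hM h1, le_max_left M 1]
  | succ V ih =>
    intro g B N D c hg hB hD hL hsign
    -- peel off the last factor: g₁ = (c V − θ) g, N₁ = c_V N D + N′D − ND′, D₁ = D²
    set g₁ : ℝ → ℝ := fun θ => (c V - θ) * g θ with hg₁
    set N₁ : ℝ[X] := C (c V) * N * D + derivative N * D - N * derivative D with hN₁
    have hg₁c : ContinuousOn g₁ (Ioi 0) := ((by fun_prop : Continuous fun θ : ℝ => c V - θ).continuousOn).mul hg
    have hB₁ := abs_sub_mul_le hB (c V)
    have hD₁ : ∀ Y, 0 < Y → (D ^ 2).eval Y ≠ 0 := fun Y hY => by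
      rw [eval_pow]; exact pow_ne_zero 2 (hD Y hY)
    -- the Laplace identity for N₁/D₁
    have hL₁ : ∀ Y, 0 < Y → N₁.eval Y / (D ^ 2).eval Y = ∫ θ in Ioi 0, Real.exp (-(Y * θ)) * g₁ θ := by
      intro Y hY
      -- derivative of N/D at Y, computed two ways
      have hq : HasDerivAt (fun Y => N.eval Y / D.eval Y)
          (((derivative N).eval Y * D.eval Y - N.eval Y * (derivative D).eval Y) / (D.eval Y) ^ 2) Y :=
        (N.hasDerivAt Y).fun_div (D.hasDerivAt Y) (hD Y hY)
      have hG := hasDerivAt_laplace hg hB hY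
      have heq : (fun Y => N.eval Y / D.eval Y) =ᶠ[nhds Y]
          fun Y => ∫ θ in Ioi 0, Real.exp (-(Y * θ)) * g θ :=
        Filter.eventually_of_mem (Ioi_mem_nhds hY) fun Z hZ => hL Z hZ
      have huniq := (hq.congr_of_eventuallyEq heq.symm).unique hG
      -- assemble
      have e1 : N₁.eval Y / (D ^ 2).eval Y = c V * (N.eval Y / D.eval Y) +
          ((derivative N).eval Y * D.eval Y - N.eval Y * (derivative D).eval Y) / (D.eval Y) ^ 2 := by
        simp only [hN₁, eval_add, eval_sub, eval_mul, eval_C, eval_pow]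
        field_simp [hD Y hY]
        ring
      rw [e1, huniq, hL Y hY, laplace_rolle_identity hg hB hY (c V)]
    have hsign₁ : (∀ θ, 0 < θ → 0 ≤ (∏ j ∈ range V, (c j - θ)) * g₁ θ) ∨
        (∀ θ, 0 < θ → (∏ j ∈ range V, (c j - θ)) * g₁ θ ≤ 0) := by
      have e : ∀ θ, (∏ j ∈ range V, (c j - θ)) * g₁ θ = (∏ j ∈ range (V + 1), (c j - θ)) * g θ := by
        intro θ; rw [hg₁, prod_range_succ]; ring
      simpa only [e] using hsign
    have h₁ := ih g₁ ((C |c V| + X) * B) N₁ (D ^ 2) c hg₁c hB₁ hD₁ hL₁ hsign₁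
    have h₂ : Multiset.card (N.roots.filter (fun y => 0 < y)) ≤
        Multiset.card (N₁.roots.filter (fun y => 0 < y)) + 1 := card_posRoots_le_rolleNum (c V) N D hD
    omega

end ToyALaw

end Summit.ValiantsHypothesis.ValiantsHypothesis.Theorems.LacunarySymmetroidMatrixDescartes
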